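import Literature.Analysis.FluidPDE.OnsagerBDSVOscillationPrincipalDiv
import Literature.Analysis.FluidPDE.OnsagerBDSVOscillationSplitProofs
import HarnessLib

/-!
# The BDSV principal oscillation term `𝒪₁`: discharge of `BDSV.oscillationPrincipalEstimate` (arXiv (6.11))

Buckmaster–De Lellis–Székelyhidi–Vicol (BDSV), *Onsager's conjecture for admissible weak
solutions*, CPAM 72 (2019) = arXiv:1701.08678, §6.1.3:

> "Thus, by Proposition C.2,
> `‖𝒪₁‖_α ≲ Σ_iΣ_{k≠0} ‖div(ρ_{q,i}∇Φ_i⁻¹C_k(R̃_{q,i})∇Φ_i⁻ᵀ)‖₀/λ_{q+1}^{1-α}`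
> ` + Σ_iΣ_{k≠0} (‖div(ρ_{q,i}∇Φ_i⁻¹C_k(R̃_{q,i})∇Φ_i⁻ᵀ)‖_{N+α} + ‖div(…)‖₀‖Φ_i‖_{N+α})/λ_{q+1}^{N-α}`
> ` ≲ Σ_iΣ_{k≠0} δ_{q+1}/(ℓλ_{q+1}^{1-α}|k|⁶) ≲ δ_{q+1}^{1/2}δ_q^{1/2}λ_q/λ_{q+1}^{1-α}, (6.11)`
> where we have used (5.7) and, as in the previous sections, a large choice of `N` to absorb the
> estimates of the second line in that for the first line."

This file PROVES the named fact `BDSV.oscillationPrincipalEstimate` of `OnsagerBDSVOscillationSplit.lean`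
(the transcription of (6.11) with the exponent `λ_{q+1}^{-(1-4α)}` of Prop. 6.1 (6.1)),

  `BDSV.oscillationPrincipalEstimate_holds : oscillationPrincipalEstimate`,

and hence, through the proved assembly `BDSV.oscillationErrorEstimate_of_parts` and the discharged
`𝒪₂` (`BDSV.oscillationCorrectorEstimate_holds`), the oscillation error (6.12),

  `BDSV.oscillationErrorEstimate_holds : oscillationErrorEstimate`.

The printed argument is followed with the Fourier expansion in `ξ` replaced by the physical-space
tools of the tree (as for the energy term G₃′, `OnsagerBDSVEnergyPrincipalProofs.lean`):
(6.10) is the proved `BDSV.PerturbationData.oscPrincipalTensor_eq_sum`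
(`OnsagerBDSVOscillationPrincipal.lean`); "(5.7) kills the fast derivative" is the proved
slow-divergence identity `BDSV.PerturbationData.tensorDivergence_principalOscMatrix_eq`
(`OnsagerBDSVOscillationPrincipalDiv.lean`), leaving `81 + 729` terms
"slow amplitude × composite of a zero-mean profile" per component and cut-off; "by Proposition C.2 …
a large choice of `N`" is the proved composite stationary-phase bound for `ℛ`
(`BDSV.PhaseFrame.levelBoundR`, `OnsagerBDSVNonstationaryPhaseAntidiv.lean`: `K` integrations by
parts in the phase frame of Prop. 5.7/Lemma 5.4, `BDSV.PerturbationData.phaseFrame`, with the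
operator constants of the proved Prop. C.1, `BDSV.holderCZBound_holds`). Contents:

* parameter algebra: `δ_{q+1}ℓ⁻¹ = δ_{q+1}^{1/2}δ_q^{1/2}λ_q^{1+3α/2}` (`BDSV.amp_succ_mul_mollScale_inv`);
  the choice of `N`: `(2π)^K(ℓλ_{q+1})^{-K} ≤ λ_{q+1}^{-1}` once `K[(b-1)(1-β) - 3α/2] > b`
  (`BDSV.exists_threshold_phaseR`, via the master lemma `BDSV.exists_freq_triple_le`); the main term
  `δ_{q+1}ℓ⁻¹n^{-(1-α)} ≤ 2π · δ_{q+1}^{1/2}δ_q^{1/2}λ_qλ_{q+1}^{-1+4α}` (`BDSV.mainScale_le`, using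
  `λ_q^{3α/2} ≤ λ_{q+1}^{3α/2}` — the factor the printed display tacitly absorbs) and the remainder
  (`BDSV.remainderScale_le`);
* one bound family `U` for all the fluctuation profiles `G̃_{cd}`, `∂_R G̃_{cd}`
  (`BDSV.MikadoDatum.exists_boundFam_osc`), the amplitude bounds
  `‖ρ_{q,i}A_{a'c}A_{jd}‖_{C^k} ≤ c³Λ²Cη'²(δ_{q+1}/c₀)ℓ^{-k}` (`BDSV.PerturbationData.scaledBound_oscAmp`,
  Lemma 5.3 and (5.23)), and the bound on one cut-off at an active time
  (`BDSV.PerturbationData.holder_antidivergence_principalOsc_le`):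
  `‖ℛ div(ρ_{q,i}A𝕎(R̃_{q,i},nΦ_i)Aᵀ)‖_{0,α} ≤ 810 F U (a_K n^{-(1-α)} + b_K n^α (nℓ)^{-K})`,
  `F = c⁴Λ³Cη'²(δ_{q+1}/c₀)ℓ⁻¹`;
* `𝒪₁ = Σ_i ℛ div(…)_i` (`BDSV.PerturbationData.antidivergence_oscPrincipalSource_eq_sum`), at most two
  cut-offs active at a time (`BDSV.CutoffFamily.sum_abs_le_two_mul`), and the assembly along
  `BDSV.StageFact` with thresholds `α < min(α₀(5.23), βb(b-1), (b-1)(1-β)/3, 1/2)`,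
  `K = ⌈2b/((b-1)(1-β))⌉ + 1`, `N̄ = max(N̄(5.23, K+2), K+2)` and constant
  `2·810·c⁴Λ³Cη'²c₀⁻¹·U·(2π a_K + b_K)`.

## References

* T. Buckmaster, C. De Lellis, L. Székelyhidi Jr., V. Vicol, *Onsager's conjecture for admissible
  weak solutions*, Comm. Pure Appl. Math. 72 (2019) 229–274 = arXiv:1701.08678, §6.1.3
  (arXiv (6.10)–(6.12)); §5.5 Prop. 5.7, Lemmas 5.3–5.4; App. C Props. C.1–C.2; Prop. 6.1 (6.1).
  Equation numbers as in arXiv:1701.08678v1 (cf. `OnsagerBDSVStressSplit.lean`, "Numbering").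
-/

open MeasureTheory Set Filter
open scoped NNReal ENNReal ContDiff Matrix Matrix.Norms.Elementwise

noncomputable section

namespace Literature.Analysis.FluidPDE

namespace BDSV

open FunctionSpaces FunctionSpaces.Torus

/-- The flat three-torus `T³ = (ℝ/ℤ)³`, local notation. -/
local notation "𝕋³" => UnitAddTorus (Fin 3)

/-- Euclidean `ℝ³`, local notation. -/
local notation "ℝ³" => EuclideanSpace ℝ (Fin 3)

/-- Real `3 × 3` matrices, local notation. -/
local notation "𝕄" => Matrix (Fin 3) (Fin 3) ℝ

/-! ## Parameter algebra: the scale `δ_{q+1} ℓ⁻¹ λ_{q+1}^{-(1-α)}` against the scale of (6.1) -/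

section Parameter

variable {β b α a : ℝ}

/-- `δ_{q+1} ℓ⁻¹ = δ_{q+1}^{1/2} δ_q^{1/2} λ_q^{1+3α/2}` (the definition (2.19) of `ℓ`).
[cite: BuckmasterEtAl2018, §2.4 (definition of ℓ)] -/
theorem amp_succ_mul_mollScale_inv (ha : 1 ≤ a) (q : ℕ) :
    amp β a b (q + 1) * (mollScale β α a b q)⁻¹ =
      Real.sqrt (amp β a b (q + 1)) * Real.sqrt (amp β a b q) * freq a b q ^ (1 + 3 * α / 2) := by
  have hδ := amp_pos (β := β) (b := b) ha (q + 1)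
  have hs : 0 < Real.sqrt (amp β a b (q + 1)) := Real.sqrt_pos.2 hδ
  rw [mollScale, inv_div, mul_div_assoc', div_eq_iff hs.ne',
    show Real.sqrt (amp β a b (q + 1)) * Real.sqrt (amp β a b q) * freq a b q ^ (1 + 3 * α / 2) *
      Real.sqrt (amp β a b (q + 1)) = (Real.sqrt (amp β a b (q + 1)) * Real.sqrt (amp β a b (q + 1))) *
        (Real.sqrt (amp β a b q) * freq a b q ^ (1 + 3 * α / 2)) by ring, Real.mul_self_sqrt hδ.le]

/-- **The choice of `N` for `𝒪₁`**: if `K[(b-1)(1-β) - 3α/2] > b` then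
`(2π)^K (ℓλ_{q+1})^{-K} ≤ λ_{q+1}^{-1}` for all `q`, once `a` is large — the `a`-exponent of
`(ℓλ_{q+1})^{-K} λ_{q+1}` is `-K[(b-1)(1-β) - 3α/2] + b < 0` ("a large choice of `N` to absorb the
estimates of the second line in that for the first line", §6.1.3).
[cite: BuckmasterEtAl2018, §6.1.3 (arXiv (6.11), choice of N)] -/
theorem exists_threshold_phaseR (hb : 1 ≤ b) {K : ℕ}
    (hK : b < K * ((b - 1) * (1 - β) - 3 * α / 2)) :
    ∃ a₁ : ℝ, 1 < a₁ ∧ ∀ a : ℝ, a₁ ≤ a → ∀ q : ℕ,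
      (2 * Real.pi) ^ K * ((mollScale β α a b q * freq a b (q + 1))⁻¹) ^ K ≤ (freq a b (q + 1))⁻¹ := by
  have hE : (K * (1 - β + 3 * α / 2)) + b * (K * (β - 1) + 1) + b ^ 2 * 0 < 0 := by nlinarith
  obtain ⟨a₁, ha₁, h⟩ := exists_freq_triple_le hb hE ((2 * Real.pi) ^ K)
  refine ⟨a₁, ha₁, fun a ha q => ?_⟩
  have ha1 : (1 : ℝ) ≤ a := ha₁.le.trans ha
  have hf0 := freq_pos (b := b) ha1 q
  have hf1 := freq_pos (b := b) ha1 (q + 1)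
  have hℓ := mollScale_pos (β := β) (α := α) (b := b) ha1 q
  have key := h a ha q
  rw [Real.rpow_zero, mul_one] at key
  -- `(ℓ λ_{q+1})⁻¹ = λ_q^{1-β+3α/2} λ_{q+1}^{β-1}`
  have hmon : (mollScale β α a b q * freq a b (q + 1))⁻¹ =
      freq a b q ^ (1 - β + 3 * α / 2) * freq a b (q + 1) ^ (β - 1) := by
    rw [mul_inv, mollScale_inv_eq ha1, show β - 1 = β + (-1) by ring, Real.rpow_add hf1,
      Real.rpow_neg_one]
    ring
  have hpowK : ((mollScale β α a b q * freq a b (q + 1))⁻¹) ^ K =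
      freq a b q ^ (K * (1 - β + 3 * α / 2)) * freq a b (q + 1) ^ (K * (β - 1)) := by
    rw [hmon, mul_pow, ← Real.rpow_natCast, ← Real.rpow_natCast, ← Real.rpow_mul hf0.le,
      ← Real.rpow_mul hf1.le, mul_comm (1 - β + 3 * α / 2), mul_comm (β - 1)]
  have hsplit : freq a b q ^ (K * (1 - β + 3 * α / 2)) * freq a b (q + 1) ^ (K * (β - 1) + 1) =
      (freq a b q ^ (K * (1 - β + 3 * α / 2)) * freq a b (q + 1) ^ (K * (β - 1))) * freq a b (q + 1) := by
    rw [Real.rpow_add hf1, Real.rpow_one]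
    ring
  rw [hsplit, ← hpowK] at key
  have hgoal : (2 * Real.pi) ^ K * ((mollScale β α a b q * freq a b (q + 1))⁻¹) ^ K ≤
      1 / freq a b (q + 1) := by
    rw [le_div_iff₀ hf1]
    calc (2 * Real.pi) ^ K * ((mollScale β α a b q * freq a b (q + 1))⁻¹) ^ K * freq a b (q + 1)
        = (2 * Real.pi) ^ K * (((mollScale β α a b q * freq a b (q + 1))⁻¹) ^ K * freq a b (q + 1)) := by
          ring
      _ ≤ 1 := key
  rwa [one_div] at hgoal

/-- `n_{q+1} ≤ λ_{q+1}` and `λ_{q+1} = 2π n_{q+1}`: `n^{s} ≤ λ_{q+1}^{s}` for `s ≥ 0`. [folklore] -/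
theorem freqNat_rpow_le (P : Params) (ha : 1 ≤ P.a) (q : ℕ) {s : ℝ} (hs : 0 ≤ s) :
    (P.freqNat q : ℝ) ^ s ≤ freq P.a P.b q ^ s := by
  have hn : (0 : ℝ) ≤ P.freqNat q := Nat.cast_nonneg _
  refine Real.rpow_le_rpow hn ?_ hs
  rw [P.freq_eq (by linarith) q]
  have hπ : (1 : ℝ) ≤ 2 * Real.pi := by
    have := Real.pi_gt_three; linarith
  nlinarith

/-- `n^{-(1-s)} ≤ 2π λ_{q+1}^{-(1-s)}` for `0 ≤ s` (`n = λ/(2π)`, `(2π)^{1-s} ≤ 2π`). [folklore] -/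
theorem freqNat_rpow_neg_le (P : Params) (ha : 1 ≤ P.a) (q : ℕ) {s : ℝ} (hs : 0 ≤ s) :
    (P.freqNat q : ℝ) ^ (-1 + s) ≤ 2 * Real.pi * freq P.a P.b q ^ (-1 + s) := by
  have hπ0 : (0 : ℝ) < 2 * Real.pi := by positivity
  have hπ : (1 : ℝ) ≤ 2 * Real.pi := by
    have := Real.pi_gt_three; linarith
  have hn : (0 : ℝ) < P.freqNat q := Nat.cast_pos.2 (P.freqNat_pos ha q)
  have hf := freq_pos (b := P.b) ha q
  have e : (P.freqNat q : ℝ) = freq P.a P.b q * (2 * Real.pi)⁻¹ := by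
    rw [P.freq_eq (by linarith) q]
    field_simp
  rw [e, Real.mul_rpow hf.le (inv_nonneg.2 hπ0.le), Real.inv_rpow hπ0.le, ← Real.rpow_neg hπ0.le,
    neg_add, neg_neg, mul_comm]
  refine mul_le_mul_of_nonneg_right ?_ (Real.rpow_nonneg hf.le _)
  calc (2 * Real.pi) ^ (1 - s) ≤ (2 * Real.pi) ^ (1 : ℝ) :=
        Real.rpow_le_rpow_of_exponent_le hπ (by linarith)
    _ = 2 * Real.pi := Real.rpow_one _

/-- **The main term against the scale of (6.1)**: for `0 ≤ α`,
`δ_{q+1} ℓ⁻¹ n_{q+1}^{-(1-α)} ≤ 2π δ_{q+1}^{1/2} δ_q^{1/2} λ_q λ_{q+1}^{-1+4α}`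
(`δ_{q+1}ℓ⁻¹ = δ_{q+1}^{1/2}δ_q^{1/2}λ_q^{1+3α/2}`, `λ_q^{3α/2} ≤ λ_{q+1}^{3α/2}`, `λ_{q+1} ≥ 1`; the printed
"`δ_{q+1}/(ℓλ_{q+1}^{1-α}) ≲ δ_{q+1}^{1/2}δ_q^{1/2}λ_q/λ_{q+1}^{1-α}`" up to the tacit `λ_q^{3α/2}`).
[cite: BuckmasterEtAl2018, §6.1.3 (arXiv (6.11), last step)] -/
theorem mainScale_le (P : Params) (ha : 1 ≤ P.a) (hb : 1 ≤ P.b) (hα : 0 ≤ P.α) (q : ℕ) :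
    amp P.β P.a P.b (q + 1) * (mollScale P.β P.α P.a P.b q)⁻¹ * (P.freqNat (q + 1) : ℝ) ^ (-1 + P.α) ≤
      2 * Real.pi * (Real.sqrt (amp P.β P.a P.b (q + 1)) * Real.sqrt (amp P.β P.a P.b q) *
        freq P.a P.b q * freq P.a P.b (q + 1) ^ (-1 + 4 * P.α)) := by
  have hf0 := freq_pos (b := P.b) ha q
  have hf1 := freq_pos (b := P.b) ha (q + 1)
  have hf1' : 1 ≤ freq P.a P.b (q + 1) := one_le_freq ha (q + 1)
  have hS : 0 ≤ Real.sqrt (amp P.β P.a P.b (q + 1)) * Real.sqrt (amp P.β P.a P.b q) := by positivity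
  rw [amp_succ_mul_mollScale_inv ha q]
  have h1 : freq P.a P.b q ^ (1 + 3 * P.α / 2) ≤ freq P.a P.b q * freq P.a P.b (q + 1) ^ (3 * P.α / 2) := by
    rw [Real.rpow_add hf0, Real.rpow_one]
    exact mul_le_mul_of_nonneg_left (Real.rpow_le_rpow hf0.le (freq_le_freq_succ ha hb q)
      (by positivity)) hf0.le
  have h2 := freqNat_rpow_neg_le P ha (q + 1) hα
  have h3 : freq P.a P.b (q + 1) ^ (3 * P.α / 2) * freq P.a P.b (q + 1) ^ (-1 + P.α) ≤
      freq P.a P.b (q + 1) ^ (-1 + 4 * P.α) := by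
    rw [← Real.rpow_add hf1]
    exact Real.rpow_le_rpow_of_exponent_le hf1' (by linarith)
  have hn0 : 0 ≤ (P.freqNat (q + 1) : ℝ) ^ (-1 + P.α) := Real.rpow_nonneg (Nat.cast_nonneg _) _
  calc Real.sqrt (amp P.β P.a P.b (q + 1)) * Real.sqrt (amp P.β P.a P.b q) * freq P.a P.b q ^ (1 + 3 * P.α / 2) *
        (P.freqNat (q + 1) : ℝ) ^ (-1 + P.α)
      ≤ Real.sqrt (amp P.β P.a P.b (q + 1)) * Real.sqrt (amp P.β P.a P.b q) *
          (freq P.a P.b q * freq P.a P.b (q + 1) ^ (3 * P.α / 2)) *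
          (2 * Real.pi * freq P.a P.b (q + 1) ^ (-1 + P.α)) :=
        mul_le_mul (mul_le_mul_of_nonneg_left h1 hS) h2 hn0 (by positivity)
    _ = 2 * Real.pi * (Real.sqrt (amp P.β P.a P.b (q + 1)) * Real.sqrt (amp P.β P.a P.b q) * freq P.a P.b q *
          (freq P.a P.b (q + 1) ^ (3 * P.α / 2) * freq P.a P.b (q + 1) ^ (-1 + P.α))) := by ring
    _ ≤ _ := by
        refine mul_le_mul_of_nonneg_left (mul_le_mul_of_nonneg_left h3 (by positivity)) (by positivity)

/-- **The remainder against the scale of (6.1)**: with `q = (n_{q+1}ℓ)⁻¹ = 2π(ℓλ_{q+1})⁻¹`, if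
`(2π)^K(ℓλ_{q+1})^{-K} ≤ λ_{q+1}^{-1}` then
`δ_{q+1} ℓ⁻¹ n_{q+1}^{α} q^K ≤ δ_{q+1}^{1/2} δ_q^{1/2} λ_q λ_{q+1}^{-1+4α}` (`0 ≤ α`).
[cite: BuckmasterEtAl2018, §6.1.3 (arXiv (6.11), the absorbed second line)] -/
theorem remainderScale_le (P : Params) (ha : 1 ≤ P.a) (hb : 1 ≤ P.b) (hα : 0 ≤ P.α) (q : ℕ) {K : ℕ}
    (hrem : (2 * Real.pi) ^ K * ((mollScale P.β P.α P.a P.b q * freq P.a P.b (q + 1))⁻¹) ^ K ≤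
      (freq P.a P.b (q + 1))⁻¹) :
    amp P.β P.a P.b (q + 1) * (mollScale P.β P.α P.a P.b q)⁻¹ *
        ((P.freqNat (q + 1) : ℝ) ^ P.α * ((((P.freqNat (q + 1) : ℝ)) * mollScale P.β P.α P.a P.b q)⁻¹) ^ K) ≤
      Real.sqrt (amp P.β P.a P.b (q + 1)) * Real.sqrt (amp P.β P.a P.b q) *
        freq P.a P.b q * freq P.a P.b (q + 1) ^ (-1 + 4 * P.α) := by
  have hf0 := freq_pos (b := P.b) ha q
  have hf1 := freq_pos (b := P.b) ha (q + 1)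
  have hf1' : 1 ≤ freq P.a P.b (q + 1) := one_le_freq ha (q + 1)
  have hℓ := mollScale_pos (β := P.β) (α := P.α) (b := P.b) ha q
  have hπ0 : (0 : ℝ) < 2 * Real.pi := by positivity
  have hS : 0 ≤ Real.sqrt (amp P.β P.a P.b (q + 1)) * Real.sqrt (amp P.β P.a P.b q) := by positivity
  -- `q^K ≤ λ_{q+1}⁻¹`
  have hqeq : (((P.freqNat (q + 1) : ℝ)) * mollScale P.β P.α P.a P.b q)⁻¹ =
      2 * Real.pi * (mollScale P.β P.α P.a P.b q * freq P.a P.b (q + 1))⁻¹ := by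
    rw [P.freq_eq (by linarith) (q + 1)]
    field_simp
  have hqK : ((((P.freqNat (q + 1) : ℝ)) * mollScale P.β P.α P.a P.b q)⁻¹) ^ K ≤ (freq P.a P.b (q + 1))⁻¹ := by
    rw [hqeq, mul_pow]
    exact hrem
  rw [amp_succ_mul_mollScale_inv ha q]
  have h1 : freq P.a P.b q ^ (1 + 3 * P.α / 2) ≤ freq P.a P.b q * freq P.a P.b (q + 1) ^ (3 * P.α / 2) := by
    rw [Real.rpow_add hf0, Real.rpow_one]
    exact mul_le_mul_of_nonneg_left (Real.rpow_le_rpow hf0.le (freq_le_freq_succ ha hb q)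
      (by positivity)) hf0.le
  have h2 : (P.freqNat (q + 1) : ℝ) ^ P.α ≤ freq P.a P.b (q + 1) ^ P.α := freqNat_rpow_le P ha (q + 1) hα
  have h3 : freq P.a P.b (q + 1) ^ (3 * P.α / 2) * (freq P.a P.b (q + 1) ^ P.α * (freq P.a P.b (q + 1))⁻¹) ≤
      freq P.a P.b (q + 1) ^ (-1 + 4 * P.α) := by
    rw [← Real.rpow_neg_one, ← Real.rpow_add hf1, ← Real.rpow_add hf1]
    exact Real.rpow_le_rpow_of_exponent_le hf1' (by linarith)
  have hn0 : 0 ≤ (P.freqNat (q + 1) : ℝ) ^ P.α := Real.rpow_nonneg (Nat.cast_nonneg _) _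
  have hq0 : 0 ≤ ((((P.freqNat (q + 1) : ℝ)) * mollScale P.β P.α P.a P.b q)⁻¹) ^ K :=
    pow_nonneg (inv_nonneg.2 (mul_nonneg (Nat.cast_nonneg _) hℓ.le)) K
  calc Real.sqrt (amp P.β P.a P.b (q + 1)) * Real.sqrt (amp P.β P.a P.b q) * freq P.a P.b q ^ (1 + 3 * P.α / 2) *
        ((P.freqNat (q + 1) : ℝ) ^ P.α * ((((P.freqNat (q + 1) : ℝ)) * mollScale P.β P.α P.a P.b q)⁻¹) ^ K)
      ≤ Real.sqrt (amp P.β P.a P.b (q + 1)) * Real.sqrt (amp P.β P.a P.b q) *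
          (freq P.a P.b q * freq P.a P.b (q + 1) ^ (3 * P.α / 2)) *
          (freq P.a P.b (q + 1) ^ P.α * (freq P.a P.b (q + 1))⁻¹) :=
        mul_le_mul (mul_le_mul_of_nonneg_left h1 hS) (mul_le_mul h2 hqK hq0 (by positivity))
          (mul_nonneg hn0 hq0) (by positivity)
    _ = Real.sqrt (amp P.β P.a P.b (q + 1)) * Real.sqrt (amp P.β P.a P.b q) * freq P.a P.b q *
          (freq P.a P.b (q + 1) ^ (3 * P.α / 2) * (freq P.a P.b (q + 1) ^ P.α * (freq P.a P.b (q + 1))⁻¹)) := by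
        ring
    _ ≤ _ := mul_le_mul_of_nonneg_left h3 (by positivity)

end Parameter

/-! ## Bound families for the Mikado fluctuation and its `R`-derivatives -/

section Profiles

variable {r : ℝ} (𝔚 : MikadoDatum r)

/-- **One bound family for all the profiles of `𝒪₁`** at level `K`: the zero-mean fluctuation
entries `G̃_{cd}` and their `R`-derivatives `∂_{R_{ab}}G̃_{cd}` on the compact Mikado ball (a constant
depending on the profile and `K` only). [folklore] -/
theorem MikadoDatum.exists_boundFam_osc (K : ℕ) :
    ∃ U : ℝ, 0 ≤ U ∧ ∀ c d, BoundFam K (𝔚.fluctZ c d) (Metric.closedBall (1 : 𝕄) r) U ∧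
      ∀ a b, BoundFam K (dR (Matrix.single a b 1) (𝔚.fluctZ c d)) (Metric.closedBall (1 : 𝕄) r) U := by
  have hK : IsCompact (Metric.closedBall (1 : 𝕄) r) := isCompact_closedBall _ _
  choose U₁ hU₁0 hU₁ using fun c d => exists_boundFam hK K (𝔚.fluctZ c d) (𝔚.jointSmooth_fluctZ c d)
  choose U₂ hU₂0 hU₂ using fun c d a b =>
    exists_boundFam hK K (dR (Matrix.single a b 1) (𝔚.fluctZ c d)) ((𝔚.jointSmooth_fluctZ c d).dR _)
  set U : ℝ := ∑ c, ∑ d, (U₁ c d + ∑ a, ∑ b, U₂ c d a b) with hUdef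
  have h2 : ∀ c d, 0 ≤ ∑ a, ∑ b, U₂ c d a b := fun c d =>
    Finset.sum_nonneg fun a _ => Finset.sum_nonneg fun b _ => hU₂0 c d a b
  have hcd : ∀ c d, U₁ c d + ∑ a, ∑ b, U₂ c d a b ≤ U := fun c d =>
    le_trans (Finset.single_le_sum (f := fun d => U₁ c d + ∑ a, ∑ b, U₂ c d a b)
      (fun d _ => add_nonneg (hU₁0 c d) (h2 c d)) (Finset.mem_univ d))
      (Finset.single_le_sum (f := fun c => ∑ d, (U₁ c d + ∑ a, ∑ b, U₂ c d a b))
        (fun c _ => Finset.sum_nonneg fun d _ => add_nonneg (hU₁0 c d) (h2 c d)) (Finset.mem_univ c))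
  have hab : ∀ c d a b, U₂ c d a b ≤ ∑ a, ∑ b, U₂ c d a b := fun c d a b =>
    le_trans (Finset.single_le_sum (f := fun b => U₂ c d a b) (fun b _ => hU₂0 c d a b) (Finset.mem_univ b))
      (Finset.single_le_sum (f := fun a => ∑ b, U₂ c d a b)
        (fun a _ => Finset.sum_nonneg fun b _ => hU₂0 c d a b) (Finset.mem_univ a))
  refine ⟨U, Finset.sum_nonneg fun c _ => Finset.sum_nonneg fun d _ => add_nonneg (hU₁0 c d) (h2 c d),
    fun c d => ⟨(hU₁ c d).mono (by linarith [hcd c d, h2 c d]),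
      fun a b => (hU₂ c d a b).mono (by linarith [hcd c d, hab c d a b, hU₁0 c d])⟩⟩

end Profiles

/-! ## The sum over the cut-offs -/

section CutoffSum

/-- The tensor divergence of a finite `Pi` sum of smooth tensor fields. [folklore] -/
theorem tensorDivergence_finset_sum {ι : Type*} (s : Finset ι) {A : ι → 𝕋³ → Fin 3 → ℝ³}
    (hA : ∀ i ∈ s, IsSmooth (A i)) (x : 𝕋³) :
    Torus.tensorDivergence (∑ i ∈ s, A i) x = ∑ i ∈ s, Torus.tensorDivergence (A i) x := by
  classical
  induction s using Finset.induction_on with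
  | empty =>
      simp only [Finset.sum_empty]
      exact Torus.tensorDivergence_zero x
  | insert a s ha ih =>
      have hs : IsSmooth (∑ i ∈ s, A i) := isSmooth_sum_pi s fun i hi => hA i (Finset.mem_insert_of_mem hi)
      rw [Finset.sum_insert ha, Finset.sum_insert ha, ← ih fun i hi => hA i (Finset.mem_insert_of_mem hi)]
      exact tensorDivergence_add (hA a (Finset.mem_insert_self a s)) hs x

variable {P : Params} {S : Setting} {Nbar : ℕ} {Cin C₀ c₀ : ℝ} {Cη : ℕ → ℕ → ℝ}

/-- **`𝒪₁ = Σ_i ℛ div(ρ_{q,i} A 𝕎(R̃_{q,i}, n_{q+1}Φ_i) Aᵀ)`** on `[0,T]`: (6.10) summed over the cut-offs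
(`BDSV.PerturbationData.oscPrincipalTensor_eq_sum`) and the linearity of `div` and `ℛ` on smooth fields.
[cite: BuckmasterEtAl2018, §6.1.3 (arXiv (6.10))] -/
theorem PerturbationData.antidivergence_oscPrincipalSource_eq_sum (H : PerturbationHypotheses P S Nbar Cin C₀)
    (𝒟 : PerturbationData P S c₀ Cη) (𝔚 : MikadoDatum mikadoRadius) (ha : 1 ≤ P.a) (hc₀ : 0 < c₀)
    (hρ : ∀ s ∈ Icc 0 S.T, 0 < rhoQ P S s) {t : ℝ} (ht : t ∈ Icc 0 S.T) :
    Torus.antidivergence (oscPrincipalSource P S 𝔚 𝒟.cut.η 𝒟.D t) =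
      ∑ i ∈ Finset.range (cutoffCount S.T (P.τ S.q)), Torus.antidivergence
        (Torus.tensorDivergence fun y j => colsOf (principalOscMatrix P S 𝔚 𝒟.cut.η 𝒟.D i t y) j) := by
  have hSi : ∀ i, IsSmooth (fun y j => colsOf (principalOscMatrix P S 𝔚 𝒟.cut.η 𝒟.D i t y) j) := fun i =>
    𝒟.isSmooth_principalOscCols H 𝔚 hc₀ hρ i ht
  have hdiv : ∀ i, IsSmooth (Torus.tensorDivergence fun y j =>
      colsOf (principalOscMatrix P S 𝔚 𝒟.cut.η 𝒟.D i t y) j) := fun i =>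
    Torus.isSmooth_finset_sum Finset.univ fun l _ => ((hSi i).column l).partialDeriv l
  have hT : oscPrincipalTensor P S 𝔚 𝒟.cut.η 𝒟.D t = ∑ i ∈ Finset.range (cutoffCount S.T (P.τ S.q)),
      (fun y j => colsOf (principalOscMatrix P S 𝔚 𝒟.cut.η 𝒟.D i t y) j) := by
    funext y j
    rw [Finset.sum_apply, Finset.sum_apply]
    exact 𝒟.oscPrincipalTensor_eq_sum H ha hc₀ hρ 𝔚 ht y j
  have hsrc : oscPrincipalSource P S 𝔚 𝒟.cut.η 𝒟.D t = ∑ i ∈ Finset.range (cutoffCount S.T (P.τ S.q)),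
      Torus.tensorDivergence (fun y j => colsOf (principalOscMatrix P S 𝔚 𝒟.cut.η 𝒟.D i t y) j) := by
    funext x
    rw [Finset.sum_apply]
    show Torus.tensorDivergence (oscPrincipalTensor P S 𝔚 𝒟.cut.η 𝒟.D t) x = _
    rw [hT]
    exact tensorDivergence_finset_sum _ (fun i _ => hSi i) x
  rw [hsrc]
  exact antidivergence_finset_sum _ fun i _ => hdiv i

end CutoffSum

/-! ## The bound on one cut-off at an active time -/

section TermBound

variable {P : Params} {S : Setting} {Nbar : ℕ} {Cin C₀ c₀ : ℝ} {Cη : ℕ → ℕ → ℝ}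

/-- `ofReal B + 3(3 ofReal B) = ofReal (10 B)`. [folklore] -/
theorem ofReal_add_nine (B : ℝ) (hB : 0 ≤ B) :
    ENNReal.ofReal B + 3 * (3 * ENNReal.ofReal B) = ENNReal.ofReal (10 * B) := by
  rw [← mul_assoc, show (3 : ℝ≥0∞) * 3 = ((9 : ℕ) : ℝ≥0∞) by norm_num, natCast_mul_ofReal,
    ← ENNReal.ofReal_add hB (by positivity)]
  congr 1
  push_cast
  ring

/-- `3(3(3(3 ofReal B))) = ofReal (81 B)`. [folklore] -/
theorem three_pow_four_mul_ofReal (B : ℝ) :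
    (3 : ℝ≥0∞) * (3 * (3 * (3 * ENNReal.ofReal B))) = ENNReal.ofReal (81 * B) := by
  rw [← mul_assoc, ← mul_assoc, ← mul_assoc,
    show (3 : ℝ≥0∞) * 3 * 3 * 3 = ((81 : ℕ) : ℝ≥0∞) by norm_num, natCast_mul_ofReal]
  push_cast
  rfl

/-- **Scaled bounds on `ρ_{q,i}(t,·)`** at order `K+2`: `‖ρ_{q,i}‖_{C^k} ≤ c Cη'² (δ_{q+1}/c₀) ℓ^{-k}`,
`c = leibConst (K+1)`, `Cη' = Σ_{k≤K+2}|C_η(0,k)|` (Lemma 5.3 for `η_i`, `ρ_q ≤ δ_{q+1}`, `Σ∫η² ≥ c₀`).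
[cite: BuckmasterEtAl2018, Lemma 5.3 and §5.2 (ρ_{q,i})] -/
theorem PerturbationData.scaledBound_rhoI (H : PerturbationHypotheses P S Nbar Cin C₀)
    (𝒟 : PerturbationData P S c₀ Cη) (hc₀ : 0 < c₀) (ha : 1 ≤ P.a) (hb : 1 ≤ P.b) (hβ : 0 ≤ P.β)
    (hα : 0 ≤ P.α) (hρ : ∀ s ∈ Icc 0 S.T, 0 < rhoQ P S s) (K : ℕ) (i : ℕ) {t : ℝ} (ht : t ∈ Icc 0 S.T) :
    ScaledBound (rhoI P S 𝒟.cut.η i t) (K + 2) (mollScale P.β P.α P.a P.b S.q)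
      (leibConst (K + 1) * (∑ k ∈ Finset.range (K + 3), |Cη 0 k|) ^ 2 * (amp P.β P.a P.b (S.q + 1) / c₀)) := by
  set ℓ := mollScale P.β P.α P.a P.b S.q with hℓdef
  set Cη' : ℝ := ∑ k ∈ Finset.range (K + 3), |Cη 0 k| with hCη'
  set c : ℝ := leibConst (K + 1) with hcdef
  set δ := amp P.β P.a P.b (S.q + 1) with hδdef
  have hℓ : 0 < ℓ := mollScale_pos ha _
  have hli : 1 ≤ ℓ⁻¹ := one_le_mollScale_inv ha hb hβ hα _
  have hδ : 0 < δ := amp_pos ha _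
  have hCη'0 : 0 ≤ Cη' := Finset.sum_nonneg fun k _ => abs_nonneg _
  set sc : ℝ := rhoQ P S t / etaMass P S 𝒟.cut.η t with hscdef
  have hsc0 : 0 ≤ sc := div_nonneg (hρ t ht).le (hc₀.le.trans (𝒟.le_etaMass ht))
  have hsc : sc ≤ δ / c₀ := div_le_div₀ hδ.le (H.rhoQ_le ha ht) hc₀ (𝒟.le_etaMass ht)
  have hηs : IsSmooth (𝒟.cut.η i t) := (𝒟.cut.smooth i).isSmooth_slice ht
  have hηB : ScaledBound (𝒟.cut.η i t) (K + 2) ℓ Cη' := by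
    intro k hk
    have h := 𝒟.cut.deriv_le i 0 k t ht
    simp only [Function.iterate_zero, id_eq, Nat.cast_zero, neg_zero, Real.rpow_zero, mul_one] at h
    refine h.trans (ENNReal.ofReal_le_ofReal ?_)
    have h1 : Cη 0 k ≤ Cη' := (le_abs_self _).trans
      (Finset.single_le_sum (f := fun k => |Cη 0 k|) (fun _ _ => abs_nonneg _)
        (Finset.mem_range.2 (by omega)))
    exact h1.trans (le_mul_of_one_le_right hCη'0 (one_le_pow₀ hli))
  have e : rhoI P S 𝒟.cut.η i t = fun x => sc * (𝒟.cut.η i t x * 𝒟.cut.η i t x) := by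
    funext x
    rw [rhoI, hscdef]
    ring
  have h := ((hηB.mul hηB hηs hηs hCη'0 hCη'0 hℓ).const_mul (hηs.mul hηs) sc)
  rw [e]
  refine h.mono_M ?_ hℓ
  rw [abs_of_nonneg hsc0]
  have hl := leib_le (N := K + 2) (K₀ := K + 1) (by omega)
  push_cast at hl ⊢
  have h1 : (3 : ℝ) ^ (K + 2) * (K + 2 + 1) * Cη' * Cη' ≤ c * Cη' ^ 2 := by
    rw [pow_two, ← mul_assoc]
    exact mul_le_mul_of_nonneg_right (mul_le_mul_of_nonneg_right hl hCη'0) hCη'0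
  calc sc * ((3 : ℝ) ^ (K + 2) * (K + 2 + 1) * Cη' * Cη') ≤ (δ / c₀) * (c * Cη' ^ 2) :=
        mul_le_mul hsc h1 (by positivity) (by positivity)
    _ = c * Cη' ^ 2 * (δ / c₀) := by ring

/-- **Scaled bounds on the conjugation amplitudes** `ρ_{q,i} A_{a'c} A_{jd}` at order `K+2` in a
phase frame of level `K+2`: `≤ c³ Λ² Cη'² (δ_{q+1}/c₀) ℓ^{-k}`. [cite: BuckmasterEtAl2018, Prop. 5.7 and Lemma 5.3] -/
theorem PerturbationData.scaledBound_oscAmp (H : PerturbationHypotheses P S Nbar Cin C₀)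
    (𝒟 : PerturbationData P S c₀ Cη) (hc₀ : 0 < c₀) (ha : 1 ≤ P.a) (hb : 1 ≤ P.b) (hβ : 0 ≤ P.β)
    (hα : 0 ≤ P.α) (hρ : ∀ s ∈ Icc 0 S.T, 0 < rhoQ P S s) {K : ℕ} {i : ℕ} {t : ℝ} (ht : t ∈ Icc 0 S.T)
    {Λ : ℝ} {Kset : Set 𝕄}
    (hP : PhaseFrame (fun x => tildeR P S 𝒟.cut.η 𝒟.D i t x) (𝒟.D i t) (P.freqNat (S.q + 1)) (K + 2)
      (mollScale P.β P.α P.a P.b S.q) Λ Kset) (a' j c' d : Fin 3) :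
    ScaledBound (oscAmp P S 𝒟.cut.η 𝒟.D i t a' j c' d) (K + 2) (mollScale P.β P.α P.a P.b S.q)
      (leibConst (K + 1) ^ 3 * Λ ^ 2 * (∑ k ∈ Finset.range (K + 3), |Cη 0 k|) ^ 2 *
        (amp P.β P.a P.b (S.q + 1) / c₀)) := by
  set ℓ := mollScale P.β P.α P.a P.b S.q with hℓdef
  set Cη' : ℝ := ∑ k ∈ Finset.range (K + 3), |Cη 0 k| with hCη'
  set c : ℝ := leibConst (K + 1) with hcdef
  set δ := amp P.β P.a P.b (S.q + 1) with hδdef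
  have hℓ : 0 < ℓ := mollScale_pos ha _
  have hδ : 0 < δ := amp_pos ha _
  have hc0 : 0 ≤ c := zero_le_one.trans (one_le_leibConst (K + 1))
  have hΛ0 : 0 ≤ Λ := zero_le_one.trans hP.one_le_Λ
  have hρB := 𝒟.scaledBound_rhoI H hc₀ ha hb hβ hα hρ K i ht
  have hρs : IsSmooth (rhoI P S 𝒟.cut.η i t) := by
    have hηs : IsSmooth (𝒟.cut.η i t) := (𝒟.cut.smooth i).isSmooth_slice ht
    have e : rhoI P S 𝒟.cut.η i t = fun x => 𝒟.cut.η i t x ^ 2 * (rhoQ P S t / etaMass P S 𝒟.cut.η t) := rfl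
    rw [e]
    exact (hηs.pow 2).mul (isSmooth_const _)
  have hA : ∀ m j, IsSmooth fun x => (jac (𝒟.D i t) x).adjugate m j := fun m j =>
    isSmooth_adjugate_jac_entry hP.smooth_D m j
  have hM₀ : 0 ≤ c * Cη' ^ 2 * (δ / c₀) := by positivity
  have hl := leib_le (N := K + 2) (K₀ := K + 1) (by omega)
  push_cast at hl
  have h1 := hρB.mul (hP.adj_bound a' c') hρs (hA a' c') hM₀ hΛ0 hℓ
  have h1' : ScaledBound (fun x => rhoI P S 𝒟.cut.η i t x * (jac (𝒟.D i t) x).adjugate a' c') (K + 2) ℓ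
      (c * (c * Cη' ^ 2 * (δ / c₀)) * Λ) := by
    refine h1.mono_M ?_ hℓ
    push_cast
    exact mul_le_mul_of_nonneg_right (mul_le_mul_of_nonneg_right hl hM₀) hΛ0
  have hM₁ : 0 ≤ c * (c * Cη' ^ 2 * (δ / c₀)) * Λ := by positivity
  have h2 := h1'.mul (hP.adj_bound j d) (hρs.mul (hA a' c')) (hA j d) hM₁ hΛ0 hℓ
  refine h2.mono_M ?_ hℓ
  push_cast
  calc (3 : ℝ) ^ (K + 2) * (K + 2 + 1) * (c * (c * Cη' ^ 2 * (δ / c₀)) * Λ) * Λ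
      ≤ c * (c * (c * Cη' ^ 2 * (δ / c₀)) * Λ) * Λ :=
        mul_le_mul_of_nonneg_right (mul_le_mul_of_nonneg_right hl hM₁) hΛ0
    _ = c ^ 3 * Λ ^ 2 * Cη' ^ 2 * (δ / c₀) := by ring

/-- **The `C^{0,r}` norm of the sum of the `81 + 729` terms of each component**, from a common
bound `B` on each `ℛ`-term: `‖ℛ(Σ_{a',j,c,d}(G₁ + Σ_{a,b}G₂))‖_{0,r} ≤ 810 B` (linearity of `ℛ` on
smooth fields and the triangle inequality). [folklore] -/
theorem holder_antidivergence_termSum_le {G₁ : Fin 3 → Fin 3 → Fin 3 → Fin 3 → 𝕋³ → ℝ³}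
    {G₂ : Fin 3 → Fin 3 → Fin 3 → Fin 3 → Fin 3 → Fin 3 → 𝕋³ → ℝ³} (hG₁s : ∀ a' j c' d, IsSmooth (G₁ a' j c' d))
    (hG₂s : ∀ a' j c' d a b, IsSmooth (G₂ a' j c' d a b)) {r : ℝ≥0} {B : ℝ} (hB : 0 ≤ B)
    (hT₁ : ∀ a' j c' d, Torus.eContDiffHolderNorm 0 r (Torus.antidivergence (G₁ a' j c' d)) ≤ ENNReal.ofReal B)
    (hT₂ : ∀ a' j c' d a b, Torus.eContDiffHolderNorm 0 r (Torus.antidivergence (G₂ a' j c' d a b)) ≤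
      ENNReal.ofReal B) :
    Torus.eContDiffHolderNorm 0 r (Torus.antidivergence
        (∑ a', ∑ j, ∑ c', ∑ d, (G₁ a' j c' d + ∑ a, ∑ b, G₂ a' j c' d a b))) ≤ ENNReal.ofReal (810 * B) := by
  have hinner : ∀ a' j c' d, IsSmooth (G₁ a' j c' d + ∑ a, ∑ b, G₂ a' j c' d a b) := fun a' j c' d =>
    (hG₁s a' j c' d).add (isSmooth_sum_pi _ fun a _ => isSmooth_sum_pi _ fun b _ => hG₂s a' j c' d a b)
  have hR : Torus.antidivergence (∑ a', ∑ j, ∑ c', ∑ d, (G₁ a' j c' d + ∑ a, ∑ b, G₂ a' j c' d a b)) =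
      ∑ a', ∑ j, ∑ c', ∑ d, (Torus.antidivergence (G₁ a' j c' d) +
        ∑ a, ∑ b, Torus.antidivergence (G₂ a' j c' d a b)) := by
    rw [antidivergence_finset_sum _ fun a' _ => isSmooth_sum_pi _ fun j _ =>
      isSmooth_sum_pi _ fun c' _ => isSmooth_sum_pi _ fun d _ => hinner a' j c' d]
    refine Finset.sum_congr rfl fun a' _ => ?_
    rw [antidivergence_finset_sum _ fun j _ => isSmooth_sum_pi _ fun c' _ => isSmooth_sum_pi _ fun d _ =>
      hinner a' j c' d]
    refine Finset.sum_congr rfl fun j _ => ?_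
    rw [antidivergence_finset_sum _ fun c' _ => isSmooth_sum_pi _ fun d _ => hinner a' j c' d]
    refine Finset.sum_congr rfl fun c' _ => ?_
    rw [antidivergence_finset_sum _ fun d _ => hinner a' j c' d]
    refine Finset.sum_congr rfl fun d _ => ?_
    rw [Torus.antidivergence_add (hG₁s a' j c' d)
      (isSmooth_sum_pi _ fun a _ => isSmooth_sum_pi _ fun b _ => hG₂s a' j c' d a b),
      antidivergence_finset_sum _ fun a _ => isSmooth_sum_pi _ fun b _ => hG₂s a' j c' d a b]
    congr 1
    exact Finset.sum_congr rfl fun a _ => antidivergence_finset_sum _ fun b _ => hG₂s a' j c' d a b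
  have hRs : ∀ w : 𝕋³ → ℝ³, IsSmooth w → IsSmooth (Torus.antidivergence w) := fun w hw =>
    Torus.isSmooth_antidivergence hw
  have hR₁s : ∀ a' j c' d, IsSmooth (Torus.antidivergence (G₁ a' j c' d)) := fun a' j c' d =>
    hRs _ (hG₁s a' j c' d)
  have hR₂s : ∀ a' j c' d a b, IsSmooth (Torus.antidivergence (G₂ a' j c' d a b)) := fun a' j c' d a b =>
    hRs _ (hG₂s a' j c' d a b)
  have hR₂ab : ∀ a' j c' d, IsSmooth (∑ a, ∑ b, Torus.antidivergence (G₂ a' j c' d a b)) :=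
    fun a' j c' d => isSmooth_sum_pi _ fun a _ => isSmooth_sum_pi _ fun b _ => hR₂s a' j c' d a b
  have hIs : ∀ a' j c' d, IsSmooth (Torus.antidivergence (G₁ a' j c' d) +
      ∑ a, ∑ b, Torus.antidivergence (G₂ a' j c' d a b)) := fun a' j c' d =>
    (hR₁s a' j c' d).add (hR₂ab a' j c' d)
  have hIn : ∀ a' j c' d, Torus.eContDiffHolderNorm 0 r (Torus.antidivergence (G₁ a' j c' d) +
      ∑ a, ∑ b, Torus.antidivergence (G₂ a' j c' d a b)) ≤ ENNReal.ofReal (10 * B) := by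
    intro a' j c' d
    refine (Torus.eContDiffHolderNorm_add_le ((hR₁s a' j c' d).isContDiff (by simp))
      ((hR₂ab a' j c' d).isContDiff (by simp))).trans ?_
    refine (add_le_add (hT₁ a' j c' d) ((Torus.eContDiffHolderNorm_sum_le _ fun a _ =>
      (isSmooth_sum_pi _ fun b _ => hR₂s a' j c' d a b).isContDiff (by simp)).trans
      (Finset.sum_le_sum fun a _ => (Torus.eContDiffHolderNorm_sum_le _ fun b _ =>
        (hR₂s a' j c' d a b).isContDiff (by simp)).trans (Finset.sum_le_sum fun b _ => hT₂ a' j c' d a b)))).trans ?_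
    rw [sum_fin_three_const, sum_fin_three_const, ofReal_add_nine B hB]
  rw [hR]
  refine (Torus.eContDiffHolderNorm_sum_le _ fun a' _ => (isSmooth_sum_pi _ fun j _ => isSmooth_sum_pi _
    fun c' _ => isSmooth_sum_pi _ fun d _ => hIs a' j c' d).isContDiff (by simp)).trans ?_
  refine (Finset.sum_le_sum fun a' _ => (Torus.eContDiffHolderNorm_sum_le _ fun j _ => (isSmooth_sum_pi _
    fun c' _ => isSmooth_sum_pi _ fun d _ => hIs a' j c' d).isContDiff (by simp)).trans
    (Finset.sum_le_sum fun j _ => (Torus.eContDiffHolderNorm_sum_le _ fun c' _ => (isSmooth_sum_pi _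
      fun d _ => hIs a' j c' d).isContDiff (by simp)).trans
      (Finset.sum_le_sum fun c' _ => (Torus.eContDiffHolderNorm_sum_le _ fun d _ =>
        (hIs a' j c' d).isContDiff (by simp)).trans (Finset.sum_le_sum fun d _ => hIn a' j c' d)))).trans ?_
  rw [sum_fin_three_const, sum_fin_three_const, sum_fin_three_const, sum_fin_three_const,
    three_pow_four_mul_ofReal]
  exact ENNReal.ofReal_le_ofReal (le_of_eq (by ring))

/-- **The bound on the `i`-th conjugated tensor at an active time** (the heart of (6.11)): in the
phase frame of the construction at level `K+2` (Prop. 5.7 for `∇Φ_i`, `adj∇Φ_i`, `R̃_{q,i}`; Lemma 5.4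
for `R̃_{q,i} ∈ B̄(Id, 1/10)`), with `nℓ ≥ 1`, operator constants `C_d, C_r` (Prop. C.1) and one
level-`K` bound family `U` for the fluctuation profiles, the slow-divergence identity and the composite
stationary-phase bound for `ℛ` give
`‖ℛ div(ρ_{q,i} A 𝕎(R̃_{q,i}, nΦ_i) Aᵀ)‖_{C^{0,r}} ≤ 810 F U (a_K n^{-(1-r)} + b_K n^r (nℓ)^{-K})`,
`F = c⁴ Λ³ Cη'² (δ_{q+1}/c₀) ℓ⁻¹`, `c = leibConst (K+1)`, `Cη' = Σ_{k ≤ K+2}|C_η(0,k)|` — i.e.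
"`‖𝒪₁‖_α ≲ Σ_i Σ_{k≠0} ‖div(ρ_{q,i}∇Φ_i⁻¹C_k∇Φ_i⁻ᵀ)‖₀/λ_{q+1}^{1-α} + … ≲ δ_{q+1}/(ℓλ_{q+1}^{1-α}) + [absorbed]`".
[cite: BuckmasterEtAl2018, §6.1.3 (arXiv (6.11))] -/
theorem PerturbationData.holder_antidivergence_principalOsc_le (H : PerturbationHypotheses P S Nbar Cin C₀)
    (𝒟 : PerturbationData P S c₀ Cη) (𝔚 : MikadoDatum mikadoRadius) (hc₀ : 0 < c₀) (hCin : 0 ≤ Cin)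
    (ha : 1 ≤ P.a) (hb : 1 ≤ P.b) (hβ : 0 ≤ P.β) (hα : 0 ≤ P.α)
    (h4 : 4 * amp P.β P.a P.b (S.q + 2) ≤ amp P.β P.a P.b (S.q + 1) * freq P.a P.b S.q ^ (-P.α))
    (hdef : Real.exp (4 * (Cin * mollScale P.β P.α P.a P.b S.q ^ (2 * P.α))) - 1 ≤ 1 / 300)
    (hstr : 8 * (Cin * (freq P.a P.b S.q ^ P.α * mollScale P.β P.α P.a P.b S.q ^ P.α)) ≤ 1 / 100)
    {K : ℕ} (hK : K + 2 ≤ Nbar) {CJ : ℝ} (hCJ : 0 ≤ CJ) {i : ℕ} {t : ℝ} (ht : t ∈ Icc 0 S.T)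
    (hJ : ∀ k ≤ K + 2, Torus.eContDiffHolderNorm k 0 (fun x => gradPhi 𝒟.D i t x) ≤
      ENNReal.ofReal (CJ * mollScale P.β P.α P.a P.b S.q ^ (-(k : ℝ))))
    (hJinv : ∀ k ≤ K + 2, Torus.eContDiffHolderNorm k 0 (fun x => (gradPhi 𝒟.D i t x)⁻¹) ≤
      ENNReal.ofReal (CJ * mollScale P.β P.α P.a P.b S.q ^ (-(k : ℝ))))
    {x' : 𝕋³} (hη : 𝒟.cut.η i t x' ≠ 0)
    (hnl : 1 ≤ (P.freqNat (S.q + 1) : ℝ) * mollScale P.β P.α P.a P.b S.q)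
    {U : ℝ} (hU0 : 0 ≤ U)
    (hU : ∀ c d, BoundFam K (𝔚.fluctZ c d) (Metric.closedBall (1 : 𝕄) mikadoRadius) U ∧
      ∀ a b, BoundFam K (dR (Matrix.single a b 1) (𝔚.fluctZ c d)) (Metric.closedBall (1 : 𝕄) mikadoRadius) U)
    {r : ℝ≥0} (hr1 : r ≤ 1) {Cd Cr : ℝ≥0}
    (hCd : ∀ A : 𝕋³ → Fin 3 → ℝ³, IsSmooth A →
      Torus.eContDiffHolderNorm 0 r (Torus.antidivergence (Torus.tensorDivergence A)) ≤
        Cd * Torus.eContDiffHolderNorm 0 r A)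
    (hCr : ∀ w : 𝕋³ → ℝ³, IsSmooth w →
      Torus.eContDiffHolderNorm 0 r (Torus.antidivergence w) ≤ Cr * Torus.eContDiffHolderNorm 0 r w) :
    Torus.eContDiffHolderNorm 0 r (Torus.antidivergence (Torus.tensorDivergence fun y j =>
        colsOf (principalOscMatrix P S 𝔚 𝒟.cut.η 𝒟.D i t y) j)) ≤
      ENNReal.ofReal (810 * (leibConst (K + 1) ^ 4 * frameConst (K + 2) CJ Cin ^ 3 *
        (∑ k ∈ Finset.range (K + 3), |Cη 0 k|) ^ 2 * (amp P.β P.a P.b (S.q + 1) / c₀) *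
        (mollScale P.β P.α P.a P.b S.q)⁻¹ * U *
        (aCoeff (K + 2) (frameConst (K + 2) CJ Cin) Cd K * (P.freqNat (S.q + 1) : ℝ) ^ (-1 + (r : ℝ)) +
          bCoeff (K + 2) (frameConst (K + 2) CJ Cin) Cr K * (P.freqNat (S.q + 1) : ℝ) ^ (r : ℝ) *
            (((P.freqNat (S.q + 1) : ℝ) * mollScale P.β P.α P.a P.b S.q)⁻¹) ^ K))) := by
  -- notation
  set ℓ := mollScale P.β P.α P.a P.b S.q with hℓdef
  set n : ℕ := P.freqNat (S.q + 1) with hndef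
  set Λ := frameConst (K + 2) CJ Cin with hΛdef
  set Cη' : ℝ := ∑ k ∈ Finset.range (K + 3), |Cη 0 k| with hCη'
  set c : ℝ := leibConst (K + 1) with hcdef
  set δ := amp P.β P.a P.b (S.q + 1) with hδdef
  set Rt : 𝕋³ → 𝕄 := fun x => tildeR P S 𝒟.cut.η 𝒟.D i t x with hRtdef
  have hℓ : 0 < ℓ := mollScale_pos ha _
  have hli0 : 0 ≤ ℓ⁻¹ := inv_nonneg.2 hℓ.le
  have hδ : 0 < δ := amp_pos ha _
  have hc1 : 1 ≤ c := one_le_leibConst (K + 1)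
  have hc0 : 0 ≤ c := zero_le_one.trans hc1
  have hCη'0 : 0 ≤ Cη' := Finset.sum_nonneg fun k _ => abs_nonneg _
  -- the frame at level `K + 2`
  have hP : PhaseFrame Rt (𝒟.D i t) n (K + 2) ℓ Λ (Metric.closedBall (1 : 𝕄) mikadoRadius) :=
    𝒟.phaseFrame H hCin ha hb hβ hα h4 hdef hstr hK hCJ ht hJ hJinv hη
  have hΛ1 : 1 ≤ Λ := hP.one_le_Λ
  have hΛ0 : 0 ≤ Λ := zero_le_one.trans hΛ1
  have hΛJ : CJ ≤ Λ := (frameConst_bounds (K + 2) hCJ hCin).2.1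
  have hρpos : ∀ s ∈ Icc 0 S.T, 0 < rhoQ P S s := fun s hs =>
    lt_of_lt_of_le (div_pos (mul_pos (amp_pos ha _) (Real.rpow_pos_of_pos (freq_pos ha _) _))
      (by norm_num)) (H.le_rhoQ h4 hs)
  have hDt : IsSmooth (𝒟.D i t) := hP.smooth_D
  -- `|∇Φ| ≤ Λ`
  have hJs : IsSmooth fun x => gradPhi 𝒟.D i t x := 𝒟.isSmooth_gradPhi H i ht
  have hJ' : ∀ x k m, |jac (𝒟.D i t) x k m| ≤ Λ := fun x k m =>
    ((scaledBound_entry hJs hℓ hJ k m).abs_le hCJ x).trans hΛJ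
  -- the conjugation amplitudes
  set F₀ : ℝ := c ^ 3 * Λ ^ 2 * Cη' ^ 2 * (δ / c₀) with hF₀def
  have hF₀ : 0 ≤ F₀ := by positivity
  have hAmpB : ∀ a' j c' d, ScaledBound (oscAmp P S 𝒟.cut.η 𝒟.D i t a' j c' d) (K + 2) ℓ F₀ :=
    fun a' j c' d => 𝒟.scaledBound_oscAmp H hc₀ ha hb hβ hα hρpos ht hP a' j c' d
  have hρs : IsSmooth (rhoI P S 𝒟.cut.η i t) := by
    have hηs : IsSmooth (𝒟.cut.η i t) := (𝒟.cut.smooth i).isSmooth_slice ht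
    exact (hηs.pow 2).mul (isSmooth_const _)
  have hA : ∀ m j, IsSmooth fun x => (jac (𝒟.D i t) x).adjugate m j := fun m j =>
    isSmooth_adjugate_jac_entry hDt m j
  have hAmps : ∀ a' j c' d, IsSmooth (oscAmp P S 𝒟.cut.η 𝒟.D i t a' j c' d) := fun a' j c' d =>
    (hρs.mul (hA a' c')).mul (hA j d)
  -- the two amplitude families of the slow divergence, at order `K + 1`
  set Fbig : ℝ := c * F₀ * Λ * ℓ⁻¹ with hFbigdef
  have hFbig : 0 ≤ Fbig := by positivity
  have hf₁s : ∀ a' j c' d, IsSmooth (Torus.partialDeriv j (oscAmp P S 𝒟.cut.η 𝒟.D i t a' j c' d)) :=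
    fun a' j c' d => (hAmps a' j c' d).partialDeriv j
  have hf₁B : ∀ a' j c' d, ScaledBound (Torus.partialDeriv j (oscAmp P S 𝒟.cut.η 𝒟.D i t a' j c' d))
      (K + 1) ℓ Fbig := by
    intro a' j c' d
    refine ((hAmpB a' j c' d).partialDeriv (hAmps a' j c' d) j).mono_M ?_ hℓ
    rw [hFbigdef]
    refine mul_le_mul_of_nonneg_right ?_ hli0
    calc F₀ = 1 * F₀ * 1 := by ring
      _ ≤ c * F₀ * Λ := mul_le_mul (mul_le_mul_of_nonneg_right hc1 hF₀) hΛ1 zero_le_one (by positivity)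
  have hRte : ∀ a b, IsSmooth fun x => Rt x a b := fun a b => isSmooth_entry hP.smooth_Rt a b
  have hRtd : ∀ j a b, IsSmooth fun x => Torus.partialDeriv j (fun y => Rt y a b) x := fun j a b =>
    (hRte a b).partialDeriv j
  have hRtdB : ∀ j a b, ScaledBound (Torus.partialDeriv j fun y => Rt y a b) (K + 1) ℓ (Λ * ℓ⁻¹) :=
    fun j a b => (hP.Rt_bound a b).partialDeriv (hRte a b) j
  have hf₂s : ∀ a' j c' d a b, IsSmooth fun x => oscAmp P S 𝒟.cut.η 𝒟.D i t a' j c' d x *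
      Torus.partialDeriv j (fun y => Rt y a b) x := fun a' j c' d a b => (hAmps a' j c' d).mul (hRtd j a b)
  have hl := leib_le (N := K + 1) (K₀ := K + 1) (by omega)
  push_cast at hl
  have hf₂B : ∀ a' j c' d a b, ScaledBound (fun x => oscAmp P S 𝒟.cut.η 𝒟.D i t a' j c' d x *
      Torus.partialDeriv j (fun y => Rt y a b) x) (K + 1) ℓ Fbig := by
    intro a' j c' d a b
    have h1 := ((hAmpB a' j c' d).mono_N (Nat.le_succ _)).mul (hRtdB j a b) (hAmps a' j c' d) (hRtd j a b)
      hF₀ (by positivity) hℓ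
    refine h1.mono_M ?_ hℓ
    push_cast
    calc (3 : ℝ) ^ (K + 1) * (K + 1 + 1) * F₀ * (Λ * ℓ⁻¹) ≤ c * F₀ * (Λ * ℓ⁻¹) :=
          mul_le_mul_of_nonneg_right (mul_le_mul_of_nonneg_right hl hF₀) (by positivity)
      _ = Fbig := by rw [hFbigdef]; ring
  -- the profiles: zero mean, joint smoothness
  have hG : ∀ c' d, JointSmooth (𝔚.fluctZ c' d) := fun c' d => 𝔚.jointSmooth_fluctZ c' d
  have hG0 : ∀ c' d (R : 𝕄), ∫ ξ, 𝔚.fluctZ c' d R ξ = 0 := fun c' d R => 𝔚.integral_fluctZ c' d R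
  have hGR : ∀ c' d a b, JointSmooth (dR (Matrix.single a b 1) (𝔚.fluctZ c' d)) := fun c' d a b =>
    (hG c' d).dR _
  have hGR0 : ∀ c' d a b (R : 𝕄), ∫ ξ, dR (Matrix.single a b 1) (𝔚.fluctZ c' d) R ξ = 0 :=
    fun c' d a b R => (hG c' d).integral_dR (hG0 c' d) _ R
  -- the level bound on each of the `81 + 729` terms of each component
  set q : ℝ := (((n : ℝ)) * ℓ)⁻¹ with hqdef
  set B : ℝ := Fbig * U * (aCoeff (K + 2) Λ Cd K * (n : ℝ) ^ (-1 + (r : ℝ)) +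
    bCoeff (K + 2) Λ Cr K * (n : ℝ) ^ (r : ℝ) * q ^ K) with hBdef
  have haK0 : 0 ≤ aCoeff (K + 2) Λ Cd K := aCoeff_nonneg (K + 2) hΛ0 (NNReal.coe_nonneg Cd) K
  have hbK0 : 0 ≤ bCoeff (K + 2) Λ Cr K := bCoeff_nonneg (K + 2) hΛ0 (NNReal.coe_nonneg Cr) K
  have hnr : (0 : ℝ) < n := Nat.cast_pos.2 (P.freqNat_pos ha _)
  have hq0 : 0 ≤ q := inv_nonneg.2 (mul_nonneg hnr.le hℓ.le)
  have hB0 : 0 ≤ B := by positivity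
  have hLB := hP.levelBoundR hnl hJ' hr1 hCd hCr
  have hnorm_e : ∀ a' : Fin 3, ‖EuclideanSpace.single a' (1 : ℝ)‖ = 1 := fun a' => by
    rw [EuclideanSpace.single, PiLp.norm_single, norm_one]
  -- the term functions
  set G₁ : Fin 3 → Fin 3 → Fin 3 → Fin 3 → 𝕋³ → ℝ³ := fun a' j c' d x =>
    (Torus.partialDeriv j (oscAmp P S 𝒟.cut.η 𝒟.D i t a' j c' d) x *
      phaseComp (𝔚.fluctZ c' d) Rt (𝒟.D i t) n x) • EuclideanSpace.single a' (1 : ℝ) with hG₁def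
  set G₂ : Fin 3 → Fin 3 → Fin 3 → Fin 3 → Fin 3 → Fin 3 → 𝕋³ → ℝ³ := fun a' j c' d a b x =>
    ((oscAmp P S 𝒟.cut.η 𝒟.D i t a' j c' d x * Torus.partialDeriv j (fun y => Rt y a b) x) *
      phaseComp (dR (Matrix.single a b 1) (𝔚.fluctZ c' d)) Rt (𝒟.D i t) n x) •
        EuclideanSpace.single a' (1 : ℝ) with hG₂def
  have hG₁s : ∀ a' j c' d, IsSmooth (G₁ a' j c' d) := fun a' j c' d =>
    ((hf₁s a' j c' d).mul ((hG c' d).phaseComp hP.smooth_Rt hDt n)).smul' (isSmooth_const _)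
  have hG₂s : ∀ a' j c' d a b, IsSmooth (G₂ a' j c' d a b) := fun a' j c' d a b =>
    ((hf₂s a' j c' d a b).mul ((hGR c' d a b).phaseComp hP.smooth_Rt hDt n)).smul' (isSmooth_const _)
  have hT₁ : ∀ a' j c' d, Torus.eContDiffHolderNorm 0 r (Torus.antidivergence (G₁ a' j c' d)) ≤
      ENNReal.ofReal B := by
    intro a' j c' d
    have h := hLB (EuclideanSpace.single a' (1 : ℝ)) K (by omega) _ _ Fbig U (hG c' d) (hG0 c' d)
      (hf₁s a' j c' d) hFbig (hf₁B a' j c' d) hU0 (hU c' d).1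
    rw [hnorm_e, one_mul] at h
    exact h
  have hT₂ : ∀ a' j c' d a b, Torus.eContDiffHolderNorm 0 r (Torus.antidivergence (G₂ a' j c' d a b)) ≤
      ENNReal.ofReal B := by
    intro a' j c' d a b
    have h := hLB (EuclideanSpace.single a' (1 : ℝ)) K (by omega) _ _ Fbig U (hGR c' d a b) (hGR0 c' d a b)
      (hf₂s a' j c' d a b) hFbig (hf₂B a' j c' d a b) hU0 ((hU c' d).2 a b)
    rw [hnorm_e, one_mul] at h
    exact h
  -- the slow-divergence identity, as `Pi` sums of the term functions
  have hdec : (Torus.tensorDivergence fun y j => colsOf (principalOscMatrix P S 𝔚 𝒟.cut.η 𝒟.D i t y) j) =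
      ∑ a', ∑ j, ∑ c', ∑ d, (G₁ a' j c' d + ∑ a, ∑ b, G₂ a' j c' d a b) := by
    funext x
    rw [𝒟.tensorDivergence_principalOscMatrix_eq H 𝔚 ha hc₀ hρpos ht hP.mem x]
    simp only [hG₁def, hG₂def, Finset.sum_apply, Pi.add_apply, oscSlowDiv, Finset.sum_smul, add_smul,
      hRtdef, hndef]
  rw [hdec]
  refine (holder_antidivergence_termSum_le hG₁s hG₂s hB0 hT₁ hT₂).trans (ENNReal.ofReal_le_ofReal (le_of_eq ?_))
  rw [hBdef, hFbigdef, hF₀def]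
  ring

end TermBound

/-! ## Assembly: the discharge of `𝒪₁` (and hence of the oscillation error (6.12)) -/

section Discharge

variable {P : Params} {S : Setting} {Nbar : ℕ} {Cin C₀ c₀ : ℝ} {Cη : ℕ → ℕ → ℝ}

/-- **Discharge of `BDSV.oscillationPrincipalEstimate`** (BDSV §6.1.3, arXiv (6.11):
`‖𝒪₁‖_α ≲ Σ_iΣ_{k≠0}‖div(ρ_{q,i}∇Φ_i⁻¹C_k(R̃_{q,i})∇Φ_i⁻ᵀ)‖₀/λ_{q+1}^{1-α} + [large N] ≲ δ_{q+1}/(ℓλ_{q+1}^{1-α})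
≲ δ_{q+1}^{1/2}δ_q^{1/2}λ_q/λ_{q+1}^{1-α}`), along the common prefix `BDSV.StageFact`: the threshold in
`α` is `min(α₀(5.23), βb(b-1), (b-1)(1-β)/3, 1/2)`; `K = ⌈2b/((b-1)(1-β))⌉ + 1` integrations by
parts (so that `(2π)^K(ℓλ_{q+1})^{-K} ≤ λ_{q+1}^{-1}`, `BDSV.exists_threshold_phaseR`); `N̄ = max(N̄(5.23, K+2), K+2)`;
the thresholds in `a` of Lemma 5.4 (`4δ_{q+2} ≤ δ_{q+1}λ_q^{-α}`, deformation, stress), of `nℓ ≥ 1`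
(arXiv (6.4)) and of the remainder; at each `t ∈ [0,T]` at most two cut-offs are active
(`BDSV.CutoffFamily.sum_abs_le_two_mul`), each bounded by `BDSV.PerturbationData.holder_antidivergence_principalOsc_le`,
and the scale comparison is `BDSV.mainScale_le` / `BDSV.remainderScale_le`. The constant is
`2 · 810 · c⁴Λ³Cη'²c₀⁻¹ · U · (2π a_K + b_K)`.
[cite: BuckmasterEtAl2018, §6.1.3 (arXiv (6.11)) with Prop. 6.1 (6.1)] -/
theorem oscillationPrincipalEstimate_holds : oscillationPrincipalEstimate := by
  intro 𝔚 c₀ hc₀ Cη β hβ hβ' b hb hb'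
  have hb0 : (0 : ℝ) < b := by linarith
  have hb1 : 0 < b - 1 := by linarith
  have h1β : 0 < 1 - β := by linarith
  have hβb : 0 < β * b * (b - 1) := by positivity
  have hpos : 0 < (b - 1) * (1 - β) := mul_pos hb1 h1β
  obtain ⟨αJ, hαJ, hJall⟩ := gradPhiBound_allOrders c₀ hc₀ Cη β hβ hβ' b hb hb'
  refine ⟨min (min αJ (β * b * (b - 1))) (min ((b - 1) * (1 - β) / 3) (1 / 2)),
    lt_min (lt_min hαJ hβb) (lt_min (by positivity) one_half_pos), fun α hα hαlt => ?_⟩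
  have hα₁ : α < αJ := lt_of_lt_of_le hαlt ((min_le_left _ _).trans (min_le_left _ _))
  have hα₂ : α < β * b * (b - 1) := lt_of_lt_of_le hαlt ((min_le_left _ _).trans (min_le_right _ _))
  have hα₃ : α < (b - 1) * (1 - β) / 3 := lt_of_lt_of_le hαlt ((min_le_right _ _).trans (min_le_left _ _))
  have hα4 : α < 1 / 2 := lt_of_lt_of_le hαlt ((min_le_right _ _).trans (min_le_right _ _))
  have hα1 : α < 1 := by linarith
  have hαb : α < 2 * β * b * (b - 1) := by nlinarith
  have hαb' : 3 * α / 2 < (b - 1) * (1 - β) := by nlinarith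
  -- the number of integrations by parts
  set K : ℕ := ⌈2 * b / ((b - 1) * (1 - β))⌉₊ + 1 with hKdef
  have hKineq : b < K * ((b - 1) * (1 - β) - 3 * α / 2) := by
    have hD : (b - 1) * (1 - β) / 2 ≤ (b - 1) * (1 - β) - 3 * α / 2 := by nlinarith
    have hKge : 2 * b / ((b - 1) * (1 - β)) < K := by
      rw [hKdef]
      push_cast
      have := Nat.le_ceil (2 * b / ((b - 1) * (1 - β)))
      linarith
    have h1 : 2 * b < K * ((b - 1) * (1 - β)) := (div_lt_iff₀ hpos).1 hKge
    have hK0 : (0 : ℝ) ≤ K := Nat.cast_nonneg _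
    nlinarith [mul_le_mul_of_nonneg_left hD hK0]
  obtain ⟨NJ, hNJ⟩ := hJall α hα hα₁ (K + 2)
  obtain ⟨U, hU0, hU⟩ := 𝔚.exists_boundFam_osc K
  -- the Hölder exponent as an `ℝ≥0` and the two operator constants (Prop. C.1)
  set r : ℝ≥0 := ⟨α, hα.le⟩ with hr
  have hr0 : 0 < r := hα
  have hr1 : r < 1 := hα1
  have hrα : Real.toNNReal α = r := by
    rw [hr]; exact Real.toNNReal_of_nonneg hα.le
  have hrr : ((r : ℝ≥0) : ℝ) = α := rfl
  clear_value r
  obtain ⟨Cd, hCd⟩ := holder_antidivergence_tensorDivergence_le holderCZBound_holds hr0 hr1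
  obtain ⟨Cr, hCr⟩ := holder_antidivergence_le holderCZBound_holds hr0 hr1
  refine ⟨max NJ (K + 2), fun Cin C₀ => ?_⟩
  -- constants
  set Cin' : ℝ := max Cin 0 with hCin'def
  have hCp0 : 0 ≤ Cin' := le_max_right _ _
  obtain ⟨CJ, aJ, haJ, hCJall⟩ := hNJ Cin' C₀
  set CJ' : ℝ := max CJ 0 with hCJ'def
  have hCJ'0 : 0 ≤ CJ' := le_max_right _ _
  set Λ : ℝ := frameConst (K + 2) CJ' Cin' with hΛdef
  have hΛ1 : 1 ≤ Λ := (frameConst_bounds (K + 2) hCJ'0 hCp0).1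
  have hΛ0 : 0 ≤ Λ := zero_le_one.trans hΛ1
  set Cη' : ℝ := ∑ k ∈ Finset.range (K + 3), |Cη 0 k| with hCη'def
  set F₁ : ℝ := leibConst (K + 1) ^ 4 * Λ ^ 3 * Cη' ^ 2 * c₀⁻¹ with hF₁def
  have hF₁ : 0 ≤ F₁ := by positivity
  set aK : ℝ := aCoeff (K + 2) Λ Cd K with haK
  set bK : ℝ := bCoeff (K + 2) Λ Cr K with hbK
  have haK0 : 0 ≤ aK := aCoeff_nonneg _ hΛ0 (NNReal.coe_nonneg Cd) K
  have hbK0 : 0 ≤ bK := bCoeff_nonneg _ hΛ0 (NNReal.coe_nonneg Cr) K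
  have hπ0 : (0 : ℝ) < 2 * Real.pi := by positivity
  -- thresholds
  obtain ⟨a₁, ha₁, hpar₁⟩ := exists_threshold_four_amp hb hαb
  obtain ⟨a₂, ha₂, hpar₂⟩ := exists_threshold_deformation hβ.le hb.le hα hCp0 (b := b)
  obtain ⟨a₃, ha₃, hpar₃⟩ := exists_threshold_freq_mul_mollScale_rpow_le hβ.le hb.le hα (8 * Cin')
    (by norm_num : (0 : ℝ) < 1 / 100)
  obtain ⟨a₄, ha₄, hpar₄⟩ := exists_threshold_phaseR hb.le hKineq (β := β) (α := α)
  obtain ⟨a₅, ha₅, hpar₅⟩ := exists_threshold_mollScale_freq_succ hb.le hαb' (2 * Real.pi) (β := β)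
  refine ⟨2 * (810 * F₁ * U * (aK * (2 * Real.pi) + bK)), max (max (max a₁ a₂) (max a₃ a₄)) (max a₅ aJ),
    lt_max_of_lt_left (lt_max_of_lt_left (lt_max_of_lt_left ha₁)), fun a ha S H 𝒟 => ?_⟩
  have ha₁' : a₁ ≤ a := le_trans (le_max_left _ _) (le_trans (le_max_left _ _) (le_trans (le_max_left _ _) ha))
  have ha₂' : a₂ ≤ a := le_trans (le_max_right _ _) (le_trans (le_max_left _ _) (le_trans (le_max_left _ _) ha))
  have ha₃' : a₃ ≤ a := le_trans (le_max_left _ _) (le_trans (le_max_right _ _) (le_trans (le_max_left _ _) ha))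
  have ha₄' : a₄ ≤ a := le_trans (le_max_right _ _) (le_trans (le_max_right _ _) (le_trans (le_max_left _ _) ha))
  have ha₅' : a₅ ≤ a := le_trans (le_max_left _ _) (le_trans (le_max_right _ _) ha)
  have haJ' : aJ ≤ a := le_trans (le_max_right _ _) (le_trans (le_max_right _ _) ha)
  have ha1 : (1 : ℝ) ≤ a := ha₁.le.trans ha₁'
  -- the hypotheses with the nonnegative constant `Cin'`
  have H' : PerturbationHypotheses ⟨β, α, a, b⟩ S (max NJ (K + 2)) Cin' C₀ := H.mono_const ha1 (le_max_left _ _)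
  have HJ : PerturbationHypotheses ⟨β, α, a, b⟩ S NJ Cin' C₀ := H'.of_le (le_max_left _ _)
  have h4 := hpar₁ a ha₁' S.q
  have hdef := hpar₂ a ha₂' S.q
  have hstr : 8 * (Cin' * (freq a b S.q ^ α * mollScale β α a b S.q ^ α)) ≤ 1 / 100 := by
    have := hpar₃ a ha₃' S.q
    linarith
  have hrem := hpar₄ a ha₄' S.q
  -- scales
  set ℓ : ℝ := mollScale β α a b S.q with hℓdef
  set n : ℕ := Params.freqNat ⟨β, α, a, b⟩ (S.q + 1) with hndef
  set δ : ℝ := amp β a b (S.q + 1) with hδdef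
  have hℓ : 0 < ℓ := mollScale_pos ha1 _
  have hδ : 0 < δ := amp_pos ha1 _
  have hnr : (0 : ℝ) < n := Nat.cast_pos.2 (Params.freqNat_pos ⟨β, α, a, b⟩ ha1 _)
  have hfreq : freq a b (S.q + 1) = 2 * Real.pi * (n : ℝ) := Params.freq_eq ⟨β, α, a, b⟩ (by linarith) (S.q + 1)
  have hnl : 1 ≤ (n : ℝ) * ℓ := by
    have h := hpar₅ a ha₅' S.q
    rw [hfreq] at h
    have h' : 2 * Real.pi * 1 ≤ 2 * Real.pi * ((n : ℝ) * ℓ) := by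
      calc 2 * Real.pi * 1 = 2 * Real.pi := mul_one _
        _ ≤ mollScale β α a b S.q * (2 * Real.pi * (n : ℝ)) := h
        _ = 2 * Real.pi * ((n : ℝ) * ℓ) := by rw [hℓdef]; ring
    exact le_of_mul_le_mul_left h' hπ0
  have hρpos : ∀ s ∈ Icc 0 S.T, 0 < rhoQ ⟨β, α, a, b⟩ S s := fun s hs =>
    lt_of_lt_of_le (div_pos (mul_pos (amp_pos ha1 _) (Real.rpow_pos_of_pos (freq_pos ha1 _) _))
      (by norm_num)) (H'.le_rhoQ h4 hs)
  -- the common bound for one cut-off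
  set Bq : ℝ := 810 * (leibConst (K + 1) ^ 4 * Λ ^ 3 * Cη' ^ 2 * (δ / c₀) * ℓ⁻¹) * U *
    (aK * (n : ℝ) ^ (-1 + α) + bK * (n : ℝ) ^ α * ((((n : ℝ)) * ℓ)⁻¹) ^ K) with hBqdef
  have hq0 : 0 ≤ ((((n : ℝ)) * ℓ)⁻¹) ^ K := pow_nonneg (inv_nonneg.2 (mul_nonneg hnr.le hℓ.le)) K
  have hBq0 : 0 ≤ Bq := by positivity
  intro t ht
  have hterm : ∀ i, Torus.eContDiffHolderNorm 0 r (Torus.antidivergence (Torus.tensorDivergence fun y j =>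
      colsOf (principalOscMatrix ⟨β, α, a, b⟩ S 𝔚 𝒟.cut.η 𝒟.D i t y) j)) ≤ ENNReal.ofReal Bq := by
    intro i
    by_cases hact : ∃ x, 𝒟.cut.η i t x ≠ 0
    · obtain ⟨x', hx'⟩ := hact
      have hti : t ∈ tildeInterval S.T (Params.τ ⟨β, α, a, b⟩ S.q) i := 𝒟.cut.mem_tildeInterval ht hx'
      have hJK := fun k hk => hCJall a haJ' S HJ 𝒟 i k hk
      have hℓk : ∀ k : ℕ, 0 ≤ ℓ ^ (-(k : ℝ)) := fun k => Real.rpow_nonneg hℓ.le _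
      have hJ : ∀ k ≤ K + 2, Torus.eContDiffHolderNorm k 0 (fun x => gradPhi 𝒟.D i t x) ≤
          ENNReal.ofReal (CJ' * ℓ ^ (-(k : ℝ))) := fun k hk =>
        ((hJK k hk).1.mono (mul_le_mul_of_nonneg_right (le_max_left _ _) (hℓk k))) t hti
      have hJinv : ∀ k ≤ K + 2, Torus.eContDiffHolderNorm k 0 (fun x => (gradPhi 𝒟.D i t x)⁻¹) ≤
          ENNReal.ofReal (CJ' * ℓ ^ (-(k : ℝ))) := fun k hk =>
        ((hJK k hk).2.mono (mul_le_mul_of_nonneg_right (le_max_left _ _) (hℓk k))) t hti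
      have h := 𝒟.holder_antidivergence_principalOsc_le H' 𝔚 hc₀ hCp0 ha1 hb.le hβ.le hα.le h4 hdef hstr
        (le_max_right _ _) hCJ'0 ht hJ hJinv hx' hnl hU0 hU hr1.le hCd hCr
      rw [hrr] at h
      refine h.trans (ENNReal.ofReal_le_ofReal (le_of_eq ?_))
      rw [hBqdef]
      ring
    · simp only [not_exists, not_not] at hact
      rw [tensorDivergence_principalOscMatrix_eq_zero_of_eta 𝔚 𝒟.cut.η 𝒟.D hact,
        show (fun _ : 𝕋³ => (0 : ℝ³)) = 0 from rfl, Torus.antidivergence_zero, Torus.eContDiffHolderNorm_zero_fun]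
      exact bot_le
  -- at most two cut-offs are active
  have hSi : ∀ i, IsSmooth (Torus.antidivergence (Torus.tensorDivergence fun y j =>
      colsOf (principalOscMatrix ⟨β, α, a, b⟩ S 𝔚 𝒟.cut.η 𝒟.D i t y) j)) := fun i =>
    Torus.isSmooth_antidivergence (Torus.isSmooth_finset_sum Finset.univ fun l _ =>
      ((𝒟.isSmooth_principalOscCols H' 𝔚 hc₀ hρpos i ht).column l).partialDeriv l)
  have hfin : ∀ i, Torus.eContDiffHolderNorm 0 r (Torus.antidivergence (Torus.tensorDivergence fun y j =>
      colsOf (principalOscMatrix ⟨β, α, a, b⟩ S 𝔚 𝒟.cut.η 𝒟.D i t y) j)) ≠ ⊤ := fun i =>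
    ((hSi i).eContDiffHolderNorm_lt_top 0 hr1.le).ne
  set g : ℕ → ℝ := fun i => (Torus.eContDiffHolderNorm 0 r (Torus.antidivergence (Torus.tensorDivergence
    fun y j => colsOf (principalOscMatrix ⟨β, α, a, b⟩ S 𝔚 𝒟.cut.η 𝒟.D i t y) j))).toReal with hgdef
  have hg0 : ∀ i, 0 ≤ g i := fun i => ENNReal.toReal_nonneg
  have hgzero : ∀ i, (∀ x, 𝒟.cut.η i t x = 0) → g i = 0 := by
    intro i hi
    simp only [hgdef]
    rw [tensorDivergence_principalOscMatrix_eq_zero_of_eta 𝔚 𝒟.cut.η 𝒟.D hi,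
      show (fun _ : 𝕋³ => (0 : ℝ³)) = 0 from rfl, Torus.antidivergence_zero, Torus.eContDiffHolderNorm_zero_fun,
      ENNReal.toReal_zero]
  have hgB : ∀ i, |g i| ≤ Bq := fun i => by
    rw [abs_of_nonneg (hg0 i)]
    exact ENNReal.toReal_le_of_le_ofReal hBq0 (hterm i)
  have hτ : 0 < Params.τ ⟨β, α, a, b⟩ S.q := glueScale_pos ha1 _
  have hsum2 := 𝒟.cut.sum_abs_le_two_mul hτ hBq0 hgzero hgB (cutoffCount S.T (Params.τ ⟨β, α, a, b⟩ S.q))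
  have hsum2' : ∑ i ∈ Finset.range (cutoffCount S.T (Params.τ ⟨β, α, a, b⟩ S.q)), g i ≤ 2 * Bq := by
    refine le_trans (le_of_eq (Finset.sum_congr rfl fun i _ => (abs_of_nonneg (hg0 i)).symm)) hsum2
  -- assemble
  dsimp only
  rw [hrα]
  rw [𝒟.antidivergence_oscPrincipalSource_eq_sum H' 𝔚 ha1 hc₀ hρpos ht]
  calc Torus.eContDiffHolderNorm 0 r (∑ i ∈ Finset.range (cutoffCount S.T (Params.τ ⟨β, α, a, b⟩ S.q)),
        Torus.antidivergence (Torus.tensorDivergence fun y j =>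
          colsOf (principalOscMatrix ⟨β, α, a, b⟩ S 𝔚 𝒟.cut.η 𝒟.D i t y) j))
      ≤ ∑ i ∈ Finset.range (cutoffCount S.T (Params.τ ⟨β, α, a, b⟩ S.q)),
          Torus.eContDiffHolderNorm 0 r (Torus.antidivergence (Torus.tensorDivergence fun y j =>
            colsOf (principalOscMatrix ⟨β, α, a, b⟩ S 𝔚 𝒟.cut.η 𝒟.D i t y) j)) :=
        Torus.eContDiffHolderNorm_sum_le _ fun i _ => (hSi i).isContDiff (by simp)
    _ = ∑ i ∈ Finset.range (cutoffCount S.T (Params.τ ⟨β, α, a, b⟩ S.q)), ENNReal.ofReal (g i) :=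
        Finset.sum_congr rfl fun i _ => (ENNReal.ofReal_toReal (hfin i)).symm
    _ = ENNReal.ofReal (∑ i ∈ Finset.range (cutoffCount S.T (Params.τ ⟨β, α, a, b⟩ S.q)), g i) :=
        (ENNReal.ofReal_sum_of_nonneg fun i _ => hg0 i).symm
    _ ≤ ENNReal.ofReal (2 * Bq) := ENNReal.ofReal_le_ofReal hsum2'
    _ ≤ _ := ENNReal.ofReal_le_ofReal ?_
  -- the scale comparison
  have hmain := mainScale_le ⟨β, α, a, b⟩ ha1 hb.le hα.le S.q
  have hremS := remainderScale_le ⟨β, α, a, b⟩ ha1 hb.le hα.le S.q (K := K) hrem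
  dsimp only at hmain hremS
  set Sc : ℝ := Real.sqrt (amp β a b (S.q + 1)) * Real.sqrt (amp β a b S.q) * freq a b S.q *
    freq a b (S.q + 1) ^ (-1 + 4 * α) with hScdef
  have e1 : Bq = 810 * F₁ * U * (aK * (δ * ℓ⁻¹ * (n : ℝ) ^ (-1 + α)) +
      bK * (δ * ℓ⁻¹ * ((n : ℝ) ^ α * ((((n : ℝ)) * ℓ)⁻¹) ^ K))) := by
    rw [hBqdef, hF₁def, div_eq_mul_inv]
    ring
  rw [e1]
  have hX : 0 ≤ 810 * F₁ * U := mul_nonneg (mul_nonneg (by norm_num) hF₁) hU0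
  have i1 : aK * (δ * ℓ⁻¹ * (n : ℝ) ^ (-1 + α)) ≤ aK * (2 * Real.pi * Sc) := mul_le_mul_of_nonneg_left hmain haK0
  have i2 : bK * (δ * ℓ⁻¹ * ((n : ℝ) ^ α * ((((n : ℝ)) * ℓ)⁻¹) ^ K)) ≤ bK * Sc :=
    mul_le_mul_of_nonneg_left hremS hbK0
  calc 2 * (810 * F₁ * U * (aK * (δ * ℓ⁻¹ * (n : ℝ) ^ (-1 + α)) +
        bK * (δ * ℓ⁻¹ * ((n : ℝ) ^ α * ((((n : ℝ)) * ℓ)⁻¹) ^ K))))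
      ≤ 2 * (810 * F₁ * U * (aK * (2 * Real.pi * Sc) + bK * Sc)) :=
        mul_le_mul_of_nonneg_left (mul_le_mul_of_nonneg_left (add_le_add i1 i2) hX) (by norm_num)
    _ = 2 * (810 * F₁ * U * (aK * (2 * Real.pi) + bK)) * Sc := by ring

/-- **Discharge of the oscillation error `BDSV.oscillationErrorEstimate`** (arXiv (6.12): "Clearly,
(6.9) and (6.11) give (6.12)"): the proved assembly `BDSV.oscillationErrorEstimate_of_parts` applied
to `BDSV.oscillationPrincipalEstimate_holds` (this file) and `BDSV.oscillationCorrectorEstimate_holds`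
(`OnsagerBDSVOscillationSplitProofs.lean`). [cite: BuckmasterEtAl2018, §6.1.3 (arXiv (6.12))] -/
theorem oscillationErrorEstimate_holds : oscillationErrorEstimate :=
  oscillationErrorEstimate_of_parts oscillationPrincipalEstimate_holds oscillationCorrectorEstimate_holds

end Discharge



end BDSV

end Literature.Analysis.FluidPDE
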